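import Literature.MathematicalPhysics.QuantumFieldTheory.Balaban1983to89.B11Eq80Current
import Literature.MathematicalPhysics.QuantumFieldTheory.Balaban1983to89.B11Prop3Model
import HarnessLib

/-!
# Route `UnitScaleTilt`, crux «MinimiserStabilityRegPr» (stmt-QuantumFields-19200, stub EX `stub_existenceMinimalOrbit`), route (α) —
# **THE (47) BRIDGE: lit's Sect. C selector `T47 H C εC` ∕ `Emap` (inside `W80`) IS `A′ ↦ A′ − H·D(A′)` WITH `D = B11Prop3Model.Dfix` (the EX display's chart selector),
# AND `Dfix` IS NATURAL UNDER LINEAR CONJUGATION OF ITS LETTERS** (def-free; SEAM (47) of LOCATE «W80-MEMBER» px18 g2 ∕ the EX namer's units paragraph 19:37:29Z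
# «`T47 H̃ C̃ εC` IS the A-units chart with `χ((ηI)•ιA′) = (ηI)•ι(T47 H̃ C̃ εC A′)`»)

Cell `ym3-torus` (HUMAN RULING D-0037, YM ladder rung R3 — YM₃ on T³ is a rung, NOT d = 4, NOT a mass gap, NOT Clay), width seat `ym3-torus-px18` (gen 2).
THEOREMS ONLY (0 `def`, 0 `sorry`); `--supports stmt-QuantumFields-19200 --as helper`; count-neutral.  Nothing of [Balaban1985Variational] is asserted: identities between
two EXISTING `Classical.epsilon` selectors of print's `D(A′)` under their EXISTING regimes (✓`B11Eq174Chart.Regime`, ✓`B11Prop3Model.Dfix_spec`'s data), by uniqueness.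

THE PRINT.  [Balaban1985Variational] p. 285: «A = A′ − HD(A′), (47) … H D(A′) = A′ − A, (48) … C_j(LʲηA′ − LʲηHD(A′)) = D(A′). (49) … This equation can be solved … (55)
|D(A′)| ≤ 4C₂|A′|²»; p. 290 (78)–(80) and p. 291 (85)–(89): every term of `W = (δ∕δA′)V` is built from `HD(A′)`, `HD₃(A′)` and their derivatives.
THE TREE.  Two formalisations of the SAME selector: (i) lit's Sect. C∕E chart `B11Eq174Chart.solA 𝒢 Λ W J ε₄ 𝔄` (the solution of `X = −𝒢J + Λ(X+𝔄) − 𝒢(W(X+𝔄))` with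
`‖X‖ ≤ ε₄`, selected by `Classical.epsilon`; unique under `Regime`), read at `(𝒢, Λ, W, J) := (H, 0, C, 0)` by `B11Eq90V0GroupComposed.T47 H C εC A′ := A′ + solA H 0 C 0 εC A′`
and `B11Eq80Current.Emap H C εC := −solA …` — the letters INSIDE `W80 = W1 + W2 + W3 + curV0full` (all four read `fderiv (Emap∕E3∕T47)`); (ii) the route's Prop.-3 model
`B11Prop3Model.Dfix C hop C₂ A′` (the solution of `C(A′ − hop X) = X` with `‖X‖ ≤ 4C₂‖A′‖²`, selected by `Classical.epsilon`; unique in `closedBall 0 (4C₂ε²)` under B13's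
contraction data) — the letter of the EX display's chart `A − H46·Dfix (CmapTwS U₀) (H46 …) C₂ A` in `hCrit93′`∕`hSplit′` (S9 ✓p660931).  No theorem related them
(`rg Dfix` over `B11Eq174Chart`∕`B11Eq90*`∕`B11Eq80*` = 0 on 2026-08-28).

WHAT IS PROVED (sorry-free, no definition).
* §1 ★`T47_eq_sub_of_fixedPoint` — under `Regime H 0 C b 0 C₂ c₄ 0 aC εC`, `‖A′‖ < aC`: ANY `X` with `C (A′ − H X) = X` and `‖H X‖ ≤ εC` gives `T47 H C εC A′ = A′ − H X`
  (the candidate `−H X` solves `mapT H 0 C 0 A′`, ✓`Regime.eq_solA`); `Emap_eq_of_fixedPoint` («`HD(A′) = H·D(A′)`», (48)); `apply_T47_eq_of_fixedPoint` («`C(A) = D(A′)`», (49)).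
* §2 ★★`T47_eq_sub_Dfix` — with B13's data for `Dfix C ↑H C₂′` (`QuadAnalytic C C₂′ R`, `‖H X‖ ≤ b′‖X‖`, `9C₂′b′ε < 1`, `3ε ≤ R`) and ONE nesting window `4C₂′b′ε² ≤ εC`:
  `T47 H C εC A′ = A′ − H (Dfix C ↑H C₂′ A′)` on `‖A′‖ < min aC ε`; `Emap_eq_Dfix`, `apply_T47_eq_Dfix`.
* §3 ★★`map_Dfix_eq_Dfix_of_conj` — NATURALITY OF THE SELECTOR under linear conjugation of its letters (carrier change AND units in one statement): for linear `r : 𝒴′ → 𝒴`,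
  `s : 𝒳′ → 𝒳` with `s (C′ B′) = C (r B′)`, `r (hop′ X′) = hop (s X′)`, `‖s X′‖ ≤ σ‖X′‖`, both B13 regimes and the nesting window `σ·4C₂′ε′² ≤ 4C₂ε²`:
  `s (Dfix C′ hop′ C₂′ A′) = Dfix C hop C₂ (r A′)` on `‖A′‖ < ε′`, `‖r A′‖ < ε` (✓`B13Contraction113.exists_unique_fixedPoint`); `Dfix_comp_eq_Dfix` (the case `s = id`:
  `Dfix (C ∘ r) hop′ C₂′ A′ = Dfix C hop C₂ (r A′)` when `r ∘ hop′ = hop`).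
HONEST SCOPE.  Uniqueness bookkeeping only; every window is displayed; nothing here instantiates `H C` at the member (the EX namer's (W) word) or claims EX, the crux, d = 4
or the mass gap.

References: T. Bałaban, CMP **102** (1985) 277–309 [Balaban1985Variational] ((47)–(49) p.285, (55) p.286, (78)–(80) p.290, (85)–(89) p.291, Prop. 6 p.295).
-/

set_option autoImplicit false

noncomputable section

namespace Summit.QuantumFields.YangMills.Theorems.Prop7T47DfixBridge

open Metric Set
open Literature.MathematicalPhysics.QuantumFieldTheory.Balaban1983to89
open B9SectCLatticeCarrier (Bond)
open B11Eq115Space (Space115)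
open B13Contraction113 (QuadAnalytic exists_unique_fixedPoint)
open B11Prop6Scheme (mapT mapT_158)
open B11Eq174Chart (solA Regime)
open B11Eq90V0GroupComposed (T47 T47_apply)
open B11Eq80Current (Emap Emap_eq_sub)
open B11Prop3Model (Dfix Dfix_spec)

/-! ## §1 The (47) bridge from ANY fixed point in the Sect. C ball -/

section Bridge

variable {𝔸 : Type*} [NormedRing 𝔸] [NormedAlgebra ℂ 𝔸] [FiniteDimensional ℂ 𝔸]
  {d : ℕ} {Pd : Fin d → ℕ} {L η : ℝ} [Fact (0 < L)] [Fact (0 < η)] {lev₀ : Bond d Pd → ℕ} {κ' : Type*} [Fintype κ'] {lev₁ : κ' → ℕ}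
  {Dc : (Bond d Pd → 𝔸) →ₗ[ℂ] (κ' → 𝔸)} {𝒳 : Type*} [NormedAddCommGroup 𝒳] [NormedSpace ℂ 𝒳]
  {H : 𝒳 →L[ℂ] Space115 L η lev₀ lev₁ Dc} {C : Space115 L η lev₀ lev₁ Dc → 𝒳} {b C₂ c₄ aC εC : ℝ}

/-- ★ **THE (47) BRIDGE**: under the Sect. C regime, ANY solution `X` of (49) `C(A′ − H X) = X` whose image `H X` lies in the `εC`-ball IS the selected `HD(A′)`:
`T47 H C εC A′ = A′ − H X` (the candidate `−H X` solves `mapT H 0 C 0 A′` and Prop. 6's uniqueness selects it). [cite: Balaban1985Variational, (47)–(49) p.285, Prop. 6 p.295] -/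
theorem T47_eq_sub_of_fixedPoint (RC : Regime H 0 C b 0 C₂ c₄ 0 aC εC) {A' : Space115 L η lev₀ lev₁ Dc} (hA' : ‖A'‖ < aC) {X : 𝒳}
    (hfix : C (A' - H X) = X) (hHX : ‖H X‖ ≤ εC) : T47 H C εC A' = A' - H X := by
  have hsol : -H X = solA H 0 C 0 εC A' := by
    refine RC.eq_solA (J := 0) (by rw [norm_zero]) hA' (by rwa [norm_neg]) ?_
    rw [mapT_158, neg_add_eq_sub, hfix]
  rw [T47_apply, ← hsol, ← sub_eq_add_neg]

/-- **(48) «`H D(A′) = A′ − A`»**: `Emap H C εC A′ = H X` for any such fixed point. [cite: Balaban1985Variational, (48) p.285] -/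
theorem Emap_eq_of_fixedPoint (RC : Regime H 0 C b 0 C₂ c₄ 0 aC εC) {A' : Space115 L η lev₀ lev₁ Dc} (hA' : ‖A'‖ < aC) {X : 𝒳}
    (hfix : C (A' - H X) = X) (hHX : ‖H X‖ ≤ εC) : Emap H C εC A' = H X := by
  rw [Emap_eq_sub, T47_eq_sub_of_fixedPoint RC hA' hfix hHX, sub_sub_cancel]

/-- **(49) «`C(A) = D(A′)`»**: `C (T47 H C εC A′) = X` for any such fixed point. [cite: Balaban1985Variational, (49) p.285] -/
theorem apply_T47_eq_of_fixedPoint (RC : Regime H 0 C b 0 C₂ c₄ 0 aC εC) {A' : Space115 L η lev₀ lev₁ Dc} (hA' : ‖A'‖ < aC) {X : 𝒳}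
    (hfix : C (A' - H X) = X) (hHX : ‖H X‖ ≤ εC) : C (T47 H C εC A') = X := by
  rw [T47_eq_sub_of_fixedPoint RC hA' hfix hHX, hfix]

/-! ## §2 … hence with `D := B11Prop3Model.Dfix C ↑H C₂′` under one nesting window -/

variable [CompleteSpace 𝒳]

omit [FiniteDimensional ℂ 𝔸] in
/-- The image `H·Dfix(A′)` lies in the `εC`-ball when `4C₂′b′ε² ≤ εC` and `‖A′‖ < ε` ((55): `‖Dfix A′‖ ≤ 4C₂′‖A′‖²`). [cite: Balaban1985Variational, (55) p.286, (51) p.285] -/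
theorem norm_H_Dfix_le {C₂' R b' ε : ℝ} (hC' : QuadAnalytic C C₂' R) (hC₂' : 0 ≤ C₂') (hb' : 0 ≤ b') (hHop' : ∀ X, ‖H X‖ ≤ b' * ‖X‖)
    (hq : 9 * C₂' * b' * ε < 1) (hRC : 3 * ε ≤ R) (hwin : 4 * C₂' * b' * ε ^ 2 ≤ εC) {A' : Space115 L η lev₀ lev₁ Dc} (hA'ε : ‖A'‖ < ε) :
    ‖H (Dfix C (H : 𝒳 →ₗ[ℂ] Space115 L η lev₀ lev₁ Dc) C₂' A')‖ ≤ εC := by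
  have hHop'' : ∀ X, ‖(H : 𝒳 →ₗ[ℂ] Space115 L η lev₀ lev₁ Dc) X‖ ≤ b' * ‖X‖ := fun X => hHop' X
  have hnorm := (Dfix_spec hC' hC₂' hb' hHop'' hq hRC hA'ε).1
  have hsq : ‖A'‖ ^ 2 ≤ ε ^ 2 := pow_le_pow_left₀ (norm_nonneg _) hA'ε.le 2
  calc ‖H (Dfix C (H : 𝒳 →ₗ[ℂ] Space115 L η lev₀ lev₁ Dc) C₂' A')‖
      ≤ b' * ‖Dfix C (H : 𝒳 →ₗ[ℂ] Space115 L η lev₀ lev₁ Dc) C₂' A'‖ := hHop' _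
    _ ≤ b' * (4 * C₂' * ‖A'‖ ^ 2) := mul_le_mul_of_nonneg_left hnorm hb'
    _ ≤ b' * (4 * C₂' * ε ^ 2) := mul_le_mul_of_nonneg_left (mul_le_mul_of_nonneg_left hsq (by positivity)) hb'
    _ = 4 * C₂' * b' * ε ^ 2 := by ring
    _ ≤ εC := hwin

/-- ★★ **THE (47) BRIDGE WITH THE ROUTE'S SELECTOR**: `T47 H C εC A′ = A′ − H·Dfix C ↑H C₂′ A′` on `‖A′‖ < min aC ε`, under the Sect. C regime, B13's contraction data for
`Dfix`, and the ONE window `4C₂′b′ε² ≤ εC` nesting `Dfix`'s image into the Sect. C ball. [cite: Balaban1985Variational, (47)–(49) p.285, (55) p.286, Prop. 6 p.295] -/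
theorem T47_eq_sub_Dfix (RC : Regime H 0 C b 0 C₂ c₄ 0 aC εC) {C₂' R b' ε : ℝ} (hC' : QuadAnalytic C C₂' R) (hC₂' : 0 ≤ C₂') (hb' : 0 ≤ b')
    (hHop' : ∀ X, ‖H X‖ ≤ b' * ‖X‖) (hq : 9 * C₂' * b' * ε < 1) (hRC : 3 * ε ≤ R) (hwin : 4 * C₂' * b' * ε ^ 2 ≤ εC)
    {A' : Space115 L η lev₀ lev₁ Dc} (hA' : ‖A'‖ < aC) (hA'ε : ‖A'‖ < ε) :
    T47 H C εC A' = A' - H (Dfix C (H : 𝒳 →ₗ[ℂ] Space115 L η lev₀ lev₁ Dc) C₂' A') := by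
  have hHop'' : ∀ X, ‖(H : 𝒳 →ₗ[ℂ] Space115 L η lev₀ lev₁ Dc) X‖ ≤ b' * ‖X‖ := fun X => hHop' X
  have hfix := (Dfix_spec hC' hC₂' hb' hHop'' hq hRC hA'ε).2
  exact T47_eq_sub_of_fixedPoint RC hA' (by simpa only [ContinuousLinearMap.coe_coe] using hfix)
    (norm_H_Dfix_le hC' hC₂' hb' hHop' hq hRC hwin hA'ε)

/-- **(48) with the route's selector**: `Emap H C εC A′ = H (Dfix C ↑H C₂′ A′)` («`HD(A′)`» IS `H` applied to `D(A′)`). [cite: Balaban1985Variational, (48) p.285] -/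
theorem Emap_eq_Dfix (RC : Regime H 0 C b 0 C₂ c₄ 0 aC εC) {C₂' R b' ε : ℝ} (hC' : QuadAnalytic C C₂' R) (hC₂' : 0 ≤ C₂') (hb' : 0 ≤ b')
    (hHop' : ∀ X, ‖H X‖ ≤ b' * ‖X‖) (hq : 9 * C₂' * b' * ε < 1) (hRC : 3 * ε ≤ R) (hwin : 4 * C₂' * b' * ε ^ 2 ≤ εC)
    {A' : Space115 L η lev₀ lev₁ Dc} (hA' : ‖A'‖ < aC) (hA'ε : ‖A'‖ < ε) :
    Emap H C εC A' = H (Dfix C (H : 𝒳 →ₗ[ℂ] Space115 L η lev₀ lev₁ Dc) C₂' A') := by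
  rw [Emap_eq_sub, T47_eq_sub_Dfix RC hC' hC₂' hb' hHop' hq hRC hwin hA' hA'ε, sub_sub_cancel]

/-- **(49) with the route's selector**: `C (T47 H C εC A′) = Dfix C ↑H C₂′ A′` («`C(A) = D(A′)`»). [cite: Balaban1985Variational, (49) p.285] -/
theorem apply_T47_eq_Dfix (RC : Regime H 0 C b 0 C₂ c₄ 0 aC εC) {C₂' R b' ε : ℝ} (hC' : QuadAnalytic C C₂' R) (hC₂' : 0 ≤ C₂') (hb' : 0 ≤ b')
    (hHop' : ∀ X, ‖H X‖ ≤ b' * ‖X‖) (hq : 9 * C₂' * b' * ε < 1) (hRC : 3 * ε ≤ R) (hwin : 4 * C₂' * b' * ε ^ 2 ≤ εC)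
    {A' : Space115 L η lev₀ lev₁ Dc} (hA' : ‖A'‖ < aC) (hA'ε : ‖A'‖ < ε) :
    C (T47 H C εC A') = Dfix C (H : 𝒳 →ₗ[ℂ] Space115 L η lev₀ lev₁ Dc) C₂' A' := by
  have hHop'' : ∀ X, ‖(H : 𝒳 →ₗ[ℂ] Space115 L η lev₀ lev₁ Dc) X‖ ≤ b' * ‖X‖ := fun X => hHop' X
  have hfix := (Dfix_spec hC' hC₂' hb' hHop'' hq hRC hA'ε).2
  rw [T47_eq_sub_Dfix RC hC' hC₂' hb' hHop' hq hRC hwin hA' hA'ε]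
  simpa only [ContinuousLinearMap.coe_coe] using hfix

end Bridge

/-! ## §3 The selector `Dfix` is natural under linear conjugation of its letters (carrier change and units) -/

section Conj

variable {𝒴 𝒴' 𝒳 𝒳' : Type*} [NormedAddCommGroup 𝒴] [NormedSpace ℂ 𝒴] [NormedAddCommGroup 𝒴'] [NormedSpace ℂ 𝒴']
  [NormedAddCommGroup 𝒳] [NormedSpace ℂ 𝒳] [NormedAddCommGroup 𝒳'] [NormedSpace ℂ 𝒳'] [CompleteSpace 𝒳] [CompleteSpace 𝒳']
  {C : 𝒴 → 𝒳} {hop : 𝒳 →ₗ[ℂ] 𝒴} {C' : 𝒴' → 𝒳'} {hop' : 𝒳' →ₗ[ℂ] 𝒴'}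

/-- ★★ **NATURALITY OF `Dfix`**: if linear `r : 𝒴′ → 𝒴`, `s : 𝒳′ → 𝒳` conjugate the letters (`s ∘ C′ = C ∘ r`, `r ∘ hop′ = hop ∘ s`, `‖s X′‖ ≤ σ‖X′‖`), then under both
contraction regimes and the window nesting the primed selection ball into the unprimed uniqueness ball, `s (Dfix C′ hop′ C₂′ A′) = Dfix C hop C₂ (r A′)` — the two
`Classical.epsilon` selections agree (the conjugate `s X′` of the primed fixed point is an unprimed fixed point in the uniqueness ball).  Covers the carrier change
(115) ↔ route functions (`s = id`, `r` the 0-jet reading) and the units conjugation `C′ = c⁻¹•C∘(c•r)`, `s = c•` in one statement.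
[cite: Balaban1985Variational, (49) p.285, (55) p.286] -/
theorem map_Dfix_eq_Dfix_of_conj (r : 𝒴' →ₗ[ℂ] 𝒴) (s : 𝒳' →ₗ[ℂ] 𝒳) (hCs : ∀ B', s (C' B') = C (r B')) (hhop : ∀ X', r (hop' X') = hop (s X'))
    {σ : ℝ} (hσ : 0 ≤ σ) (hs : ∀ X', ‖s X'‖ ≤ σ * ‖X'‖)
    {C₂ R b ε : ℝ} (hC : QuadAnalytic C C₂ R) (hC₂ : 0 ≤ C₂) (hb : 0 ≤ b) (hHop : ∀ X, ‖hop X‖ ≤ b * ‖X‖) (hq : 9 * C₂ * b * ε < 1) (hRC : 3 * ε ≤ R)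
    {C₂' R' b' ε' : ℝ} (hC' : QuadAnalytic C' C₂' R') (hC₂' : 0 ≤ C₂') (hb' : 0 ≤ b') (hHop' : ∀ X', ‖hop' X'‖ ≤ b' * ‖X'‖) (hq' : 9 * C₂' * b' * ε' < 1)
    (hRC' : 3 * ε' ≤ R') (hnest : σ * (4 * C₂' * ε' ^ 2) ≤ 4 * C₂ * ε ^ 2)
    {A' : 𝒴'} (hA' : ‖A'‖ < ε') (hA : ‖r A'‖ < ε) :
    s (Dfix C' hop' C₂' A') = Dfix C hop C₂ (r A') := by
  obtain ⟨hn', hfix'⟩ := Dfix_spec hC' hC₂' hb' hHop' hq' hRC' hA'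
  obtain ⟨hn, hfix⟩ := Dfix_spec hC hC₂ hb hHop hq hRC hA
  obtain ⟨X, -, -, huniq⟩ := exists_unique_fixedPoint hC hC₂ hb hHop hA hq hRC
  -- the unprimed selection lies in the uniqueness ball
  have h1 : Dfix C hop C₂ (r A') = X := by
    refine huniq _ (mem_closedBall_zero_iff.2 (hn.trans ?_)) hfix
    exact mul_le_mul_of_nonneg_left (pow_le_pow_left₀ (norm_nonneg _) hA.le 2) (by positivity)
  -- the conjugate of the primed selection is an unprimed fixed point in the uniqueness ball
  have h2fix : C (r A' - hop (s (Dfix C' hop' C₂' A'))) = s (Dfix C' hop' C₂' A') := by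
    rw [← hhop, ← map_sub, ← hCs, hfix']
  have h2mem : s (Dfix C' hop' C₂' A') ∈ closedBall (0 : 𝒳) (4 * C₂ * ε ^ 2) := by
    refine mem_closedBall_zero_iff.2 ((hs _).trans (le_trans ?_ hnest))
    refine mul_le_mul_of_nonneg_left (hn'.trans ?_) hσ
    exact mul_le_mul_of_nonneg_left (pow_le_pow_left₀ (norm_nonneg _) hA'.le 2) (by positivity)
  rw [huniq _ h2mem h2fix, h1]

/-- **Carrier change alone** (`s = id`): `Dfix (C ∘ r) hop′ C₂′ A′ = Dfix C hop C₂ (r A′)` when `r ∘ hop′ = hop` — e.g. `r` = the 0-jet reading of the space (115) onto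
the route's bond functions, `hop′` the (115)-valued `H`, `hop = H46`-type. [cite: Balaban1985Variational, (49) p.285, (55) p.286] -/
theorem Dfix_comp_eq_Dfix (r : 𝒴' →ₗ[ℂ] 𝒴) {hop₁ : 𝒳 →ₗ[ℂ] 𝒴'} (hhop : ∀ X, r (hop₁ X) = hop X)
    {C₂ R b ε : ℝ} (hC : QuadAnalytic C C₂ R) (hC₂ : 0 ≤ C₂) (hb : 0 ≤ b) (hHop : ∀ X, ‖hop X‖ ≤ b * ‖X‖) (hq : 9 * C₂ * b * ε < 1) (hRC : 3 * ε ≤ R)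
    {C₂' R' b' ε' : ℝ} (hC' : QuadAnalytic (fun B' : 𝒴' => C (r B')) C₂' R') (hC₂' : 0 ≤ C₂') (hb' : 0 ≤ b') (hHop' : ∀ X, ‖hop₁ X‖ ≤ b' * ‖X‖)
    (hq' : 9 * C₂' * b' * ε' < 1) (hRC' : 3 * ε' ≤ R') (hnest : 4 * C₂' * ε' ^ 2 ≤ 4 * C₂ * ε ^ 2)
    {A' : 𝒴'} (hA' : ‖A'‖ < ε') (hA : ‖r A'‖ < ε) :
    Dfix (fun B' : 𝒴' => C (r B')) hop₁ C₂' A' = Dfix C hop C₂ (r A') := by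
  have h := map_Dfix_eq_Dfix_of_conj (C := C) (hop := hop) (C' := fun B' : 𝒴' => C (r B')) (hop' := hop₁) r (LinearMap.id : 𝒳 →ₗ[ℂ] 𝒳)
    (fun _ => rfl) (fun X => by rw [LinearMap.id_apply, hhop]) zero_le_one (fun X => by rw [LinearMap.id_apply, one_mul])
    hC hC₂ hb hHop hq hRC hC' hC₂' hb' hHop' hq' hRC' (by rwa [one_mul]) hA' hA
  rwa [LinearMap.id_apply] at h

/-- **Units conjugation** (`s = c•`, `C′ = c⁻¹ • C ∘ (c • r)`): for `c ≠ 0`, `c • Dfix (fun B′ ↦ c⁻¹ • C (c • r B′)) hop′ C₂′ A′ = Dfix C hop C₂ (c • r A′)` when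
`c • r (hop′ X′) = hop (c • X′)` — the A-units ↔ exponent-units reading of the chart of record (`c = η·I`-type). [cite: Balaban1985Variational, (49) p.285, (55) p.286] -/
theorem smul_Dfix_conj_eq (r : 𝒴' →ₗ[ℂ] 𝒴) {hop₁ : 𝒳 →ₗ[ℂ] 𝒴'} {c : ℂ} (hc : c ≠ 0) (hhop : ∀ X, c • r (hop₁ X) = hop (c • X))
    {C₂ R b ε : ℝ} (hC : QuadAnalytic C C₂ R) (hC₂ : 0 ≤ C₂) (hb : 0 ≤ b) (hHop : ∀ X, ‖hop X‖ ≤ b * ‖X‖) (hq : 9 * C₂ * b * ε < 1) (hRC : 3 * ε ≤ R)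
    {C₂' R' b' ε' : ℝ} (hC' : QuadAnalytic (fun B' : 𝒴' => c⁻¹ • C (c • r B')) C₂' R') (hC₂' : 0 ≤ C₂') (hb' : 0 ≤ b') (hHop' : ∀ X, ‖hop₁ X‖ ≤ b' * ‖X‖)
    (hq' : 9 * C₂' * b' * ε' < 1) (hRC' : 3 * ε' ≤ R') (hnest : ‖c‖ * (4 * C₂' * ε' ^ 2) ≤ 4 * C₂ * ε ^ 2)
    {A' : 𝒴'} (hA' : ‖A'‖ < ε') (hA : ‖c • r A'‖ < ε) :
    c • Dfix (fun B' : 𝒴' => c⁻¹ • C (c • r B')) hop₁ C₂' A' = Dfix C hop C₂ (c • r A') := by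
  have h := map_Dfix_eq_Dfix_of_conj (C := C) (hop := hop) (C' := fun B' : 𝒴' => c⁻¹ • C (c • r B')) (hop' := hop₁) (c • r)
    (c • (LinearMap.id : 𝒳 →ₗ[ℂ] 𝒳))
    (fun B' => by rw [LinearMap.smul_apply, LinearMap.id_apply, smul_smul, mul_inv_cancel₀ hc, one_smul, LinearMap.smul_apply])
    (fun X => by rw [LinearMap.smul_apply, LinearMap.smul_apply, LinearMap.id_apply, hhop]) (norm_nonneg c)
    (fun X => by rw [LinearMap.smul_apply, LinearMap.id_apply, norm_smul])
    hC hC₂ hb hHop hq hRC hC' hC₂' hb' hHop' hq' hRC' hnest hA' (by rwa [LinearMap.smul_apply])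
  rwa [LinearMap.smul_apply, LinearMap.id_apply, LinearMap.smul_apply] at h

end Conj

end Summit.QuantumFields.YangMills.Theorems.Prop7T47DfixBridge

end
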